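import Summits.HodgeConjecture.HodgeConjecture.Theorems.PadicSemiregularLiftFermatAnchorAssemblyStubRigidLiftStep
import Mathlib.Algebra.Order.Antidiag.Finsupp

/-!
# `stub_rigidLift` — RIGID `L`-GRADED MATRIX FACTORIZATIONS OF THE FERMAT FORM LIFT TO THE WITT VECTORS

Registered stub `stub_rigidLift` of line `witt-lift-rigid-mf` of crux `FermatAnchorAssembly`
(stmt-HodgeConjecture-14874, route `PadicSemiregularLift` of `HodgeConjecture`), over the vocabulary of
`Theorems/PadicSemiregularLiftFermatAnchorAssemblyGMFDefs.lean`: for a perfect field `𝕜` of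
characteristic `p` and a lawful `L`-graded matrix factorization `M = (φ, ψ)` of `Σ_{i<ν} xᵢᵐ` over `𝕜`
with `GMFData.IsRigid 𝕜 L M` (`Hom(M, M(m)) = 0` in `L`-degree `0`), there is a lawful `L`-graded
factorization `M_W` over `𝕎 𝕜` with the same labels whose entrywise reduction along
`WittVector.constantCoeff : 𝕎 𝕜 →+* 𝕜` is `M`.

PROOF (pure algebra). `liftStep` (file `…StubRigidLiftStep.lean`; rigidity enters through
`closedSet_subset_nullSet_of_isRigid`, file `…StubRigidLiftAux.lean`) improves a bihomogeneous pair
`(Φₙ, Ψₙ)` over `𝕎 𝕜` reducing to `(φ, ψ)` with `ΦₙΨₙ ≡ f·1 ≡ ΨₙΦₙ (mod pⁿ⁺¹)` to such a pair modulo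
`pⁿ⁺²`, congruent to the old one modulo `pⁿ⁺¹`; the Teichmüller lift of `(φ, ψ)` starts the induction
(`liftBase`). All entries range over the FIXED finite sets of monomials of their bidegrees
(`Finset.finsuppAntidiag`), so the coefficientwise limit `Φ = WittVector.mk p (t ↦ t-th Witt coefficient
at level t)` is a matrix of polynomials (`exists_limit_matrix`), congruent to level `t` modulo `pᵗ⁺¹`
for every `t` (`limit_spec`); hence `ΦΨ = f·1 = ΨΦ` and `Φ ≡ φ`, `Ψ ≡ ψ (mod p)` hold in every Witt
component (`limit_mul_eq`). No named fact, no `sorry`.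
-/

-- `Summit.HodgeConjecture.HodgeConjecture.…` is the tree's mandated summit/problem namespace (single-problem summit).
set_option linter.dupNamespace false

noncomputable section

open Finset

namespace Summit.HodgeConjecture.HodgeConjecture.Cruxes.FermatAnchorAssembly.WittLiftRigidMf

namespace RigidLift

/-! ### Fixed finite monomial supports -/

/-- A bihomogeneous polynomial of `ℤ`-degree `d` is supported on the finite set of exponents of total
degree `d.toNat`. [folklore] -/
theorem support_subset_finsuppAntidiag {R : Type} [CommSemiring R] {ν m : ℕ}
    {L : AddSubgroup (Fin ν → ZMod m)} {q : MvPolynomial (Fin ν) R} {d : ℤ} {c : Fin ν → ZMod m}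
    (h : IsBihom m L q d c) :
    q.support ⊆ Finset.finsuppAntidiag (Finset.univ : Finset (Fin ν)) d.toNat := by
  intro e he
  rw [Finset.mem_finsuppAntidiag]
  refine ⟨?_, Finset.subset_univ _⟩
  obtain ⟨h1, -⟩ := h e he
  simp only [zdeg] at h1
  rw [← h1, Int.toNat_natCast]

/-! ### Coefficientwise limits over `𝕎 k` -/

/-- Coefficients of a polynomial given by its coefficient function. [folklore] -/
theorem coeff_ofCoeff {R σ : Type} [CommSemiring R] (F : (σ →₀ ℕ) →₀ R) (e : σ →₀ ℕ) :
    MvPolynomial.coeff e (AddMonoidAlgebra.ofCoeff F : MvPolynomial σ R) = F e := rfl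

section Limit

variable {p : ℕ} [Fact p.Prime] {k σ κ ι o : Type} [CommRing k]

/-- The coefficientwise LIMIT of a sequence of polynomials over `𝕎 k` supported in a fixed finite set:
its `e`-th coefficient has `t`-th Witt component that of the `t`-th polynomial; its support lies in the
union of the supports. [folklore] -/
theorem exists_limit_poly (S : Finset (σ →₀ ℕ)) (qs : ℕ → MvPolynomial σ (WittVector p k))
    (hS : ∀ t, (qs t).support ⊆ S) :
    ∃ q : MvPolynomial σ (WittVector p k), (∀ e t, (q.coeff e).coeff t = ((qs t).coeff e).coeff t) ∧
      ∀ e ∈ q.support, ∃ t, e ∈ (qs t).support := by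
  classical
  have hzero : ∀ e, (∀ t, e ∉ (qs t).support) →
      (WittVector.mk p fun t ↦ ((qs t).coeff e).coeff t) = 0 := by
    intro e he
    ext t
    simp only [WittVector.coeff_mk, MvPolynomial.notMem_support_iff.mp (he t), WittVector.zero_coeff]
  refine ⟨AddMonoidAlgebra.ofCoeff (Finsupp.onFinset S
    (fun e ↦ WittVector.mk p fun t ↦ ((qs t).coeff e).coeff t) fun e he ↦ ?_), fun e t ↦ ?_,
    fun e he ↦ ?_⟩
  · by_contra hne
    exact he (hzero e fun t h ↦ hne (hS t h))
  · rw [coeff_ofCoeff, Finsupp.onFinset_apply, WittVector.coeff_mk]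
  · by_contra hne
    push Not at hne
    refine MvPolynomial.mem_support_iff.mp he ?_
    rw [coeff_ofCoeff, Finsupp.onFinset_apply]
    exact hzero e hne

/-- Coefficientwise limits of sequences of matrices of polynomials over `𝕎 k` with entrywise fixed finite
supports. [folklore] -/
theorem exists_limit_matrix (S : κ → ι → Finset (σ →₀ ℕ))
    (Xs : ℕ → Matrix κ ι (MvPolynomial σ (WittVector p k))) (hS : ∀ t a i, (Xs t a i).support ⊆ S a i) :
    ∃ X : Matrix κ ι (MvPolynomial σ (WittVector p k)),
      (∀ a i e t, ((X a i).coeff e).coeff t = ((Xs t a i).coeff e).coeff t) ∧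
        ∀ a i, ∀ e ∈ (X a i).support, ∃ t, e ∈ (Xs t a i).support := by
  choose g hg hg' using fun a i ↦ exists_limit_poly (S a i) (fun t ↦ Xs t a i) fun t ↦ hS t a i
  exact ⟨Matrix.of g, fun a i ↦ hg a i, fun a i ↦ hg' a i⟩

/-- The limit of a COMPATIBLE sequence (`X_{t+1} ≡ X_t (mod pᵗ⁺¹)`) is congruent to `X_t` modulo
`pᵗ⁺¹`. [folklore] -/
theorem limit_spec {Xs : ℕ → Matrix κ ι (MvPolynomial σ (WittVector p k))}
    {X : Matrix κ ι (MvPolynomial σ (WittVector p k))}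
    (hX : ∀ a i e t, ((X a i).coeff e).coeff t = ((Xs t a i).coeff e).coeff t)
    (hcompat : ∀ t, (Xs (t + 1)).map (MvPolynomial.map (WittVector.truncate (t + 1))) =
      (Xs t).map (MvPolynomial.map (WittVector.truncate (t + 1)))) (t : ℕ) :
    X.map (MvPolynomial.map (WittVector.truncate (t + 1))) =
      (Xs t).map (MvPolynomial.map (WittVector.truncate (t + 1))) := by
  rw [map_truncate_eq_iff]
  intro a i e s hs
  rw [hX]
  have key : ∀ t, s ≤ t → ((Xs s a i).coeff e).coeff s = ((Xs t a i).coeff e).coeff s := by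
    intro t hst
    induction t, hst using Nat.le_induction with
    | base => rfl
    | succ t hst ih =>
      rw [ih]
      exact ((map_truncate_eq_iff _ _ _).mp (hcompat t) a i e s (Nat.lt_succ_of_le hst)).symm
  exact key t (Nat.lt_succ_iff.mp hs)

/-- The limit reduces modulo `p` like level `0`. [folklore] -/
theorem limit_map_constantCoeff {Xs : ℕ → Matrix κ ι (MvPolynomial σ (WittVector p k))}
    {X : Matrix κ ι (MvPolynomial σ (WittVector p k))}
    (hX : ∀ a i e t, ((X a i).coeff e).coeff t = ((Xs t a i).coeff e).coeff t) :
    X.map (MvPolynomial.map WittVector.constantCoeff) =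
      (Xs 0).map (MvPolynomial.map WittVector.constantCoeff) :=
  (map_constantCoeff_eq_iff X (Xs 0)).mpr fun a i e ↦ hX a i e 0

/-- Products pass to the limit: if `X ≡ X_t`, `Y ≡ Y_t` and `X_t Y_t ≡ F (mod pᵗ⁺¹)` for all `t` then
`XY = F`. [folklore] -/
theorem limit_mul_eq [Fintype ι] {Xs : ℕ → Matrix κ ι (MvPolynomial σ (WittVector p k))}
    {Ys : ℕ → Matrix ι o (MvPolynomial σ (WittVector p k))}
    {X : Matrix κ ι (MvPolynomial σ (WittVector p k))} {Y : Matrix ι o (MvPolynomial σ (WittVector p k))}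
    {F : Matrix κ o (MvPolynomial σ (WittVector p k))}
    (hX : ∀ t, X.map (MvPolynomial.map (WittVector.truncate (t + 1))) =
      (Xs t).map (MvPolynomial.map (WittVector.truncate (t + 1))))
    (hY : ∀ t, Y.map (MvPolynomial.map (WittVector.truncate (t + 1))) =
      (Ys t).map (MvPolynomial.map (WittVector.truncate (t + 1))))
    (hF : ∀ t, (Xs t * Ys t).map (MvPolynomial.map (WittVector.truncate (t + 1))) =
      F.map (MvPolynomial.map (WittVector.truncate (t + 1)))) :
    X * Y = F := by
  refine Matrix.ext fun a i ↦ MvPolynomial.ext _ _ fun e ↦ WittVector.ext fun t ↦ ?_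
  have h := hF t
  rw [Matrix.map_mul, ← hX t, ← hY t, ← Matrix.map_mul, map_truncate_eq_iff] at h
  exact h a i e t (Nat.lt_succ_self t)

end Limit

/-! ### The base of the induction and the stub -/

section Main

variable {p : ℕ} [Fact p.Prime] {𝕜 : Type} [Field 𝕜] {ν m : ℕ} {ι₀ ι₁ : Type} [Fintype ι₀] [Fintype ι₁]
  [DecidableEq ι₀] [DecidableEq ι₁] {L : AddSubgroup (Fin ν → ZMod m)}

variable (p) in
/-- Level `0`: the Teichmüller lift of `(φ, ψ)` is bihomogeneous, reduces to `(φ, ψ)` and is lawful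
modulo `p`. [folklore] -/
theorem liftBase (M : GMF 𝕜 ν m L ι₀ ι₁) :
    ∃ (Φ : Matrix ι₀ ι₁ (MvPolynomial (Fin ν) (WittVector p 𝕜)))
      (Ψ : Matrix ι₁ ι₀ (MvPolynomial (Fin ν) (WittVector p 𝕜))),
      (∀ i j, IsBihom m L (Φ i j) (M.d₁ j - M.d₀ i) (M.c₁ j - M.c₀ i)) ∧
      (∀ j i, IsBihom m L (Ψ j i) (M.d₀ i + m - M.d₁ j) (M.c₀ i - M.c₁ j)) ∧
      Φ.map (MvPolynomial.map WittVector.constantCoeff) = M.φ ∧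
      Ψ.map (MvPolynomial.map WittVector.constantCoeff) = M.ψ ∧
      (Φ * Ψ).map (MvPolynomial.map (WittVector.truncate (0 + 1))) =
        (fermatForm (WittVector p 𝕜) ν m • (1 : Matrix ι₀ ι₀ (MvPolynomial (Fin ν) (WittVector p 𝕜)))).map
          (MvPolynomial.map (WittVector.truncate (0 + 1))) ∧
      (Ψ * Φ).map (MvPolynomial.map (WittVector.truncate (0 + 1))) =
        (fermatForm (WittVector p 𝕜) ν m • (1 : Matrix ι₁ ι₁ (MvPolynomial (Fin ν) (WittVector p 𝕜)))).map
          (MvPolynomial.map (WittVector.truncate (0 + 1))) := by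
  obtain ⟨Φ, hΦ, hΦs⟩ := exists_lift_matrix p 𝕜 M.φ
  obtain ⟨Ψ, hΨ, hΨs⟩ := exists_lift_matrix p 𝕜 M.ψ
  refine ⟨Φ, Ψ, fun i j ↦ (M.φ_bihom i j).of_support_subset (hΦs i j),
    fun j i ↦ (M.ψ_bihom j i).of_support_subset (hΨs j i), hΦ, hΨ, ?_, ?_⟩
  · apply map_truncate_one_eq_of_map_constantCoeff_eq
    rw [Matrix.map_mul, hΦ, hΨ, M.φ_mul_ψ, smul_one_map, map_fermatForm]
  · apply map_truncate_one_eq_of_map_constantCoeff_eq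
    rw [Matrix.map_mul, hΦ, hΨ, M.ψ_mul_φ, smul_one_map, map_fermatForm]

end Main

end RigidLift

open RigidLift in
/-- **`stub_rigidLift` (L1∞ of line `witt-lift-rigid-mf`): RIGID `L`-graded matrix factorizations of
the Fermat form `Σ_{i<ν} xᵢᵐ` over a perfect field `𝕜` of characteristic `p` lift to the Witt vectors
`𝕎 𝕜` with the same labels, reducing entrywise to the given one under `WittVector.constantCoeff`.**
Induction over `𝕎/pⁿ⁺¹` by `liftStep` (the obstruction class of each step is a closed even cochain of
twist `m`, null-homotopic by rigidity) from the Teichmüller lift (`liftBase`), then the coefficientwise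
`p`-adic limit over the fixed finite monomial supports (`exists_limit_matrix`, `limit_spec`,
`limit_mul_eq`). [folklore] -/
theorem stub_rigidLift :
    ∀ (p : ℕ) [Fact p.Prime] (𝕜 : Type) [Field 𝕜] [CharP 𝕜 p] [PerfectRing 𝕜 p] (ν m : ℕ)
    (ι₀ ι₁ : Type) [Fintype ι₀] [Fintype ι₁] [DecidableEq ι₀] [DecidableEq ι₁]
    (L : AddSubgroup (Fin ν → ZMod m)) (M : GMF 𝕜 ν m L ι₀ ι₁), GMFData.IsRigid 𝕜 L M.toGMFData →
    ∃ MW : GMF (WittVector p 𝕜) ν m L ι₀ ι₁,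
      MW.toGMFData.map (WittVector.constantCoeff : WittVector p 𝕜 →+* 𝕜) = M.toGMFData := by
  intro p _ 𝕜 _ _ _ ν m ι₀ ι₁ _ _ _ _ L M hM
  -- the invariant of level `n` (lawful modulo `pⁿ⁺¹`)
  let Inv : ℕ → Matrix ι₀ ι₁ (MvPolynomial (Fin ν) (WittVector p 𝕜)) ×
      Matrix ι₁ ι₀ (MvPolynomial (Fin ν) (WittVector p 𝕜)) → Prop := fun n X ↦
    (∀ i j, IsBihom m L (X.1 i j) (M.d₁ j - M.d₀ i) (M.c₁ j - M.c₀ i)) ∧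
    (∀ j i, IsBihom m L (X.2 j i) (M.d₀ i + m - M.d₁ j) (M.c₀ i - M.c₁ j)) ∧
    X.1.map (MvPolynomial.map WittVector.constantCoeff) = M.φ ∧
    X.2.map (MvPolynomial.map WittVector.constantCoeff) = M.ψ ∧
    (X.1 * X.2).map (MvPolynomial.map (WittVector.truncate (n + 1))) =
      (fermatForm (WittVector p 𝕜) ν m • (1 : Matrix ι₀ ι₀ (MvPolynomial (Fin ν) (WittVector p 𝕜)))).map
        (MvPolynomial.map (WittVector.truncate (n + 1))) ∧
    (X.2 * X.1).map (MvPolynomial.map (WittVector.truncate (n + 1))) =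
      (fermatForm (WittVector p 𝕜) ν m • (1 : Matrix ι₁ ι₁ (MvPolynomial (Fin ν) (WittVector p 𝕜)))).map
        (MvPolynomial.map (WittVector.truncate (n + 1)))
  -- the (total) step
  have hstep : ∀ (n : ℕ) (X : Matrix ι₀ ι₁ (MvPolynomial (Fin ν) (WittVector p 𝕜)) ×
      Matrix ι₁ ι₀ (MvPolynomial (Fin ν) (WittVector p 𝕜))), ∃ X' : Matrix ι₀ ι₁
        (MvPolynomial (Fin ν) (WittVector p 𝕜)) × Matrix ι₁ ι₀ (MvPolynomial (Fin ν) (WittVector p 𝕜)),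
      Inv n X → Inv (n + 1) X' ∧
        X'.1.map (MvPolynomial.map (WittVector.truncate (n + 1))) =
          X.1.map (MvPolynomial.map (WittVector.truncate (n + 1))) ∧
        X'.2.map (MvPolynomial.map (WittVector.truncate (n + 1))) =
          X.2.map (MvPolynomial.map (WittVector.truncate (n + 1))) := by
    intro n X
    by_cases h : Inv n X
    · obtain ⟨h1, h2, h3, h4, h5, h6⟩ := h
      obtain ⟨Φ', Ψ', H1, H2, H3, H4, H5, H6, H7, H8⟩ :=
        liftStep p 𝕜 ν m ι₀ ι₁ L M hM n X.1 X.2 h1 h2 h3 h4 h5 h6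
      exact ⟨(Φ', Ψ'), fun _ ↦ ⟨⟨H1, H2, H3, H4, H5, H6⟩, H7, H8⟩⟩
    · exact ⟨X, fun h' ↦ absurd h' h⟩
  choose next hnext using hstep
  -- the sequence
  obtain ⟨Φ₀, Ψ₀, hbase⟩ := liftBase p M
  let seq : ℕ → Matrix ι₀ ι₁ (MvPolynomial (Fin ν) (WittVector p 𝕜)) ×
      Matrix ι₁ ι₀ (MvPolynomial (Fin ν) (WittVector p 𝕜)) :=
    fun n ↦ Nat.rec (Φ₀, Ψ₀) (fun n X ↦ next n X) n
  have hseq : ∀ n, seq (n + 1) = next n (seq n) := fun n ↦ rfl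
  have hInv : ∀ n, Inv n (seq n) := by
    intro n
    induction n with
    | zero => exact hbase
    | succ n ih => rw [hseq]; exact (hnext n (seq n) ih).1
  have hcompat₁ : ∀ t, (seq (t + 1)).1.map (MvPolynomial.map (WittVector.truncate (t + 1))) =
      (seq t).1.map (MvPolynomial.map (WittVector.truncate (t + 1))) :=
    fun t ↦ by rw [hseq]; exact (hnext t (seq t) (hInv t)).2.1
  have hcompat₂ : ∀ t, (seq (t + 1)).2.map (MvPolynomial.map (WittVector.truncate (t + 1))) =
      (seq t).2.map (MvPolynomial.map (WittVector.truncate (t + 1))) :=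
    fun t ↦ by rw [hseq]; exact (hnext t (seq t) (hInv t)).2.2
  -- the limits
  obtain ⟨Φ, hΦ, hΦsupp⟩ := exists_limit_matrix
    (fun i j ↦ Finset.finsuppAntidiag (Finset.univ : Finset (Fin ν)) (M.d₁ j - M.d₀ i).toNat)
    (fun t ↦ (seq t).1) fun t i j ↦ support_subset_finsuppAntidiag ((hInv t).1 i j)
  obtain ⟨Ψ, hΨ, hΨsupp⟩ := exists_limit_matrix
    (fun j i ↦ Finset.finsuppAntidiag (Finset.univ : Finset (Fin ν)) (M.d₀ i + m - M.d₁ j).toNat)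
    (fun t ↦ (seq t).2) fun t j i ↦ support_subset_finsuppAntidiag ((hInv t).2.1 j i)
  have hΦlim := limit_spec hΦ hcompat₁
  have hΨlim := limit_spec hΨ hcompat₂
  have hΦred : Φ.map (MvPolynomial.map WittVector.constantCoeff) = M.φ := by
    rw [limit_map_constantCoeff hΦ]; exact (hInv 0).2.2.1
  have hΨred : Ψ.map (MvPolynomial.map WittVector.constantCoeff) = M.ψ := by
    rw [limit_map_constantCoeff hΨ]; exact (hInv 0).2.2.2.1
  refine
    ⟨{ d₀ := M.d₀
       d₁ := M.d₁
       c₀ := M.c₀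
       c₁ := M.c₁
       φ := Φ
       ψ := Ψ
       φ_bihom := fun i j e he ↦ ?_
       ψ_bihom := fun j i e he ↦ ?_
       φ_mul_ψ := limit_mul_eq hΦlim hΨlim fun t ↦ (hInv t).2.2.2.2.1
       ψ_mul_φ := limit_mul_eq hΨlim hΦlim fun t ↦ (hInv t).2.2.2.2.2 }, ?_⟩
  · obtain ⟨t, ht⟩ := hΦsupp i j e he
    exact (hInv t).1 i j e ht
  · obtain ⟨t, ht⟩ := hΨsupp j i e he
    exact (hInv t).2.1 j i e ht
  · simp only [GMFData.map]
    rw [hΦred, hΨred]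

end Summit.HodgeConjecture.HodgeConjecture.Cruxes.FermatAnchorAssembly.WittLiftRigidMf

end
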